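import Summits.MatrixMultiplication.MatrixMultiplication.Theorems.ConeTensor
import Summits.MatrixMultiplication.MatrixMultiplication.Theorems.ConeTensorApex
import Summits.MatrixMultiplication.MatrixMultiplication.Theorems.TetrahedronTensorKronecker
import Summits.MatrixMultiplication.MatrixMultiplication.Theorems.ConeTensorKronecker
import HarnessLib

/-!
# ConeTensorApexExponent — part 3 of 3: **`ω(K₄) ≤ (2/3)·ω(W)`** (Christandl–Vrana–Zuiddam
arXiv:1609.07476 Prop. 2.1.7 at `G = K₄`, `f = (n²,n²,n²,n,n,n)`, `N = n⁹`, re-proved in kernel from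
`R₄(T(K₄)_{n⁶}) ≤ R₄(W_n)⁴` and the level certificates `omegaTetra_le_of_level`), hence
**`ConeFlat ⟹ TetraFlat`** (`ω(W) ≤ 6 → ω(K₄) ≤ 4`); conversely the cone is a restriction of
`T(K₄)_{n·n}` (`cone_eq_pullback_tetra_sq`), so `R₄(W_n) ≤ R₄(T(K₄)_{n·n})`, `ω(W) ≤ 2·ω(K₄)`, and the
kernel sandwich `(3/2)·ω(K₄) ≤ ω(W) ≤ 2·ω(K₄)`. No `sorry`, no new axiom, no instance, no notation,
no `Prop`-valued definition.
-/

noncomputable section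

set_option linter.dupNamespace false

open scoped BigOperators
open Filter Asymptotics Module
open Literature.Computability.AlgebraicComplexity
open Summit.MatrixMultiplication.MatrixMultiplication.Theorems.TetrahedronTensor

namespace Summit.MatrixMultiplication.MatrixMultiplication.Theorems.ConeTensor
/-! ## `ω(K₄) ≤ (2/3)·ω(W)` and `ConeFlat ⟹ TetraFlat` -/

section Exponent

variable (F : Type*) [Field F]

/-- **`ω(K₄) ≤ (2/3)·ω(W)`**, for every field: from `R₄(T(K₄)_{N⁶}) ≤ R₄(W_N)⁴ ≤ D⁴ N^{4γ} ≤
(N⁶)^{(4γ+ε)/6}` at one large level `N` and the level certificate `omegaTetra_le_of_level`.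
[cite: ChristandlVranaZuiddam2016, Prop. 1.1.16] -/
theorem omegaTetra_le_twoThirds_mul_omegaCone : omegaTetra F ≤ 2 / 3 * omegaCone F := by
  have key : ∀ γ ∈ coneAdmissibleExponents F, ∀ ε : ℝ, 0 < ε →
      omegaTetra F ≤ (4 * γ + ε) / 6 := by
    intro γ hγ ε hε
    have hγ6 : 6 ≤ γ := six_le_of_mem_coneAdmissibleExponents F hγ
    obtain ⟨D, hD0, hD⟩ := isBigO_iff'.1 hγ
    have hDε : ∀ᶠ N : ℕ in atTop, D ^ 4 ≤ (N : ℝ) ^ ε :=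
      ((tendsto_rpow_atTop hε).comp tendsto_natCast_atTop_atTop).eventually_ge_atTop (D ^ 4)
    obtain ⟨N, ⟨hN2, hDN⟩, hWN⟩ := (((eventually_ge_atTop 2).and hDε).and hD).exists
    rw [Real.norm_of_nonneg (Nat.cast_nonneg _),
      Real.norm_of_nonneg (Real.rpow_nonneg (Nat.cast_nonneg _) _)] at hWN
    have hNpos : (0 : ℝ) < N := by exact_mod_cast (show 0 < N by omega)
    have hL2 : 2 ≤ (N * N) ^ 3 :=
      hN2.trans ((Nat.le_mul_self N).trans (Nat.le_self_pow (by norm_num) _))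
    have hθ : 0 ≤ (4 * γ + ε) / 6 := by positivity
    refine omegaTetra_le_of_level F hL2 hθ ?_
    have h1 : (tensorRankD (tetra F ((N * N) ^ 3)) : ℝ) ≤ (tensorRankD (cone F N) : ℝ) ^ 4 := by
      exact_mod_cast tensorRankD_tetra_cube_le (F := F) N
    have h2 : (tensorRankD (cone F N) : ℝ) ^ 4 ≤ (D * (N : ℝ) ^ γ) ^ 4 :=
      pow_le_pow_left₀ (Nat.cast_nonneg _) hWN 4
    have h3 : (D * (N : ℝ) ^ γ) ^ 4 = D ^ 4 * (N : ℝ) ^ (4 * γ) := by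
      rw [mul_pow, ← Real.rpow_natCast ((N : ℝ) ^ γ) 4, ← Real.rpow_mul hNpos.le]
      congr 1
      push_cast
      ring
    have h4 : D ^ 4 * (N : ℝ) ^ (4 * γ) ≤ (N : ℝ) ^ ε * (N : ℝ) ^ (4 * γ) :=
      mul_le_mul_of_nonneg_right hDN (Real.rpow_nonneg hNpos.le _)
    have h6 : (((N * N) ^ 3 : ℕ) : ℝ) = (N : ℝ) ^ (6 : ℝ) := by
      rw [show (6 : ℝ) = ((6 : ℕ) : ℝ) by norm_num, Real.rpow_natCast]
      push_cast
      ring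
    have h5 : (N : ℝ) ^ ε * (N : ℝ) ^ (4 * γ) = (((N * N) ^ 3 : ℕ) : ℝ) ^ ((4 * γ + ε) / 6) := by
      rw [← Real.rpow_add hNpos, h6, ← Real.rpow_mul hNpos.le]
      congr 1
      ring
    calc (tensorRankD (tetra F ((N * N) ^ 3)) : ℝ) ≤ (tensorRankD (cone F N) : ℝ) ^ 4 := h1
      _ ≤ (D * (N : ℝ) ^ γ) ^ 4 := h2
      _ = D ^ 4 * (N : ℝ) ^ (4 * γ) := h3
      _ ≤ (N : ℝ) ^ ε * (N : ℝ) ^ (4 * γ) := h4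
      _ = (((N * N) ^ 3 : ℕ) : ℝ) ^ ((4 * γ + ε) / 6) := h5
  by_contra hlt
  rw [not_le] at hlt
  have hδ : 0 < omegaTetra F - 2 / 3 * omegaCone F := by linarith
  have hγ : omegaCone F + (omegaTetra F - 2 / 3 * omegaCone F) / 4 ∈ coneAdmissibleExponents F :=
    mem_coneAdmissibleExponents_of_lt F (by linarith)
  have := key _ hγ ((omegaTetra F - 2 / 3 * omegaCone F) / 4) (by linarith)
  linarith

/-- **`ConeFlat ⟹ TetraFlat`** (`ω(W) ≤ 6 → ω(K₄) ≤ 4`), for every field: the attacked conjunct of the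
cone carving implies the attacked conjunct of the tetrahedron carving. [folklore] -/
theorem omegaTetra_le_four_of_omegaCone_le_six (h : omegaCone F ≤ 6) : omegaTetra F ≤ 4 := by
  have := omegaTetra_le_twoThirds_mul_omegaCone F
  linarith

/-- The two-sided bracket `ω(K₄) ≤ min(2ω, (2/3)·ω(W))`. [folklore] -/
theorem omegaTetra_le_min : omegaTetra F ≤ min (2 * omega F) (2 / 3 * omegaCone F) :=
  le_min (omegaTetra_le_two_mul_omega F) (omegaTetra_le_twoThirds_mul_omegaCone F)

/-- **A cone level certificate is a tetrahedron instrument**: one finite certificate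
`R₄(W_N) ≤ N^θ` (`N ≥ 2`, `θ ≥ 0`) gives `ω(K₄) ≤ (2/3)·θ` (so a certificate with `θ < 7.1616`
would beat the cover `ω(K₄) ≤ 2ω < 4.7744`, and `θ → 6` gives `TetraFlat`).
[cite: ChristandlVranaZuiddam2016, Prop. 1.1.16, Prop. 2.1.7] -/
theorem omegaTetra_le_of_cone_level {N : ℕ} {θ : ℝ} (hN : 2 ≤ N) (hθ : 0 ≤ θ)
    (hcert : (tensorRankD (cone F N) : ℝ) ≤ (N : ℝ) ^ θ) : omegaTetra F ≤ 2 / 3 * θ :=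
  calc omegaTetra F ≤ 2 / 3 * omegaCone F := omegaTetra_le_twoThirds_mul_omegaCone F
    _ ≤ 2 / 3 * θ := mul_le_mul_of_nonneg_left (omegaCone_le_of_level F hN hθ hcert) (by norm_num)

end Exponent

/-! ## Conversely: the cone is a restriction of `T(K₄)_{n·n}`, `ω(W) ≤ 2·ω(K₄)` -/

section Restriction

variable {n : ℕ}

/-- Zero the second half of a pair label: `y ↦ (P₁-half of y, 0)`. -/
def zr [NeZero n] (y : Fin (n * n)) : Fin (n * n) := finProdFinEquiv ((finProdFinEquiv.symm y).1, 0)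

/-- Keep slot `0` (the spoke), zero the second halves of slots `1, 2` (the rim edges). -/
def ζ [NeZero n] (x : Fin ((n * n) ^ 3)) : Fin ((n * n) ^ 3) :=
  enc (finFunctionFinEquiv.symm x 0) (zr (finFunctionFinEquiv.symm x 1)) (zr (finFunctionFinEquiv.symm x 2))

/-- Slot/half bookkeeping for the relabelling in `P₁_ζ₀`. [folklore] -/
theorem P₁_ζ₀ [NeZero n] (x : Fin ((n * n) ^ 3)) : P₁ (ζ x) 0 = P₁ x 0 := by rw [ζ, P₁_enc₀]; rfl
/-- Slot/half bookkeeping for the relabelling in `P₂_ζ₀`. [folklore] -/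
theorem P₂_ζ₀ [NeZero n] (x : Fin ((n * n) ^ 3)) : P₂ (ζ x) 0 = P₂ x 0 := by rw [ζ, P₂_enc₀]; rfl
/-- Slot/half bookkeeping for the relabelling in `P₁_ζ₁`. [folklore] -/
theorem P₁_ζ₁ [NeZero n] (x : Fin ((n * n) ^ 3)) : P₁ (ζ x) 1 = P₁ x 1 := by
  rw [ζ, P₁_enc₁]; simp [zr]; rfl
/-- Slot/half bookkeeping for the relabelling in `P₂_ζ₁`. [folklore] -/
theorem P₂_ζ₁ [NeZero n] (x : Fin ((n * n) ^ 3)) : P₂ (ζ x) 1 = 0 := by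
  rw [ζ, P₂_enc₁]; simp [zr]
/-- Slot/half bookkeeping for the relabelling in `P₁_ζ₂`. [folklore] -/
theorem P₁_ζ₂ [NeZero n] (x : Fin ((n * n) ^ 3)) : P₁ (ζ x) 2 = P₁ x 2 := by
  rw [ζ, P₁_enc₂]; simp [zr]; rfl
/-- Slot/half bookkeeping for the relabelling in `P₂_ζ₂`. [folklore] -/
theorem P₂_ζ₂ [NeZero n] (x : Fin ((n * n) ^ 3)) : P₂ (ζ x) 2 = 0 := by
  rw [ζ, P₂_enc₂]; simp [zr]

/-- The restriction maps: identity at the apex, `ζ` at the rim vertices. -/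
def coneToTetra [NeZero n] : Fin 4 → Fin ((n * n) ^ 3) → Fin ((n * n) ^ 3) := ![id, ζ, ζ, ζ]

variable {F : Type*} [Field F]

/-- **The cone is the restriction of `T(K₄)_{n·n}` to rim labels with second half `0`** (there the
rim face factor is `1`). [folklore] -/
theorem cone_eq_pullback_tetra_sq (n : ℕ) [NeZero n] :
    cone F n = fun i => tetra F (n * n) (fun v => coneToTetra v (i v)) := by
  funext i
  rw [tetra_sq_apply]
  simp only [cone, coneToTetra, matMulTensor, ite_one_zero_mul_ite, Matrix.cons_val_zero,
    Matrix.cons_val_one, Matrix.cons_val_two, Matrix.cons_val_three, Matrix.head_cons,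
    Matrix.tail_cons, id, P₁_ζ₀, P₂_ζ₀, P₁_ζ₁, P₂_ζ₁, P₁_ζ₂, P₂_ζ₂]
  refine if_congr ?_ rfl rfl
  tauto

/-- **`R₄(W_n) ≤ R₄(T(K₄)_{n·n})`**. [folklore] -/
theorem tensorRankD_cone_le_tetra_sq (n : ℕ) [NeZero n] :
    tensorRankD (cone F n) ≤ tensorRankD (tetra F (n * n)) := by
  rw [cone_eq_pullback_tetra_sq (F := F) n]
  exact tensorRankD_pullback_le (tetra F (n * n)) coneToTetra (tetra_decomposable (n * n))

variable (F)

/-- If `β` is admissible for the tetrahedron then `2β` is admissible for the cone. [folklore] -/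
theorem two_mul_mem_coneAdmissibleExponents {β : ℝ} (hβ : β ∈ tetraAdmissibleExponents F) :
    2 * β ∈ coneAdmissibleExponents F := by
  have hβ4 : 4 ≤ β := four_le_of_mem_tetraAdmissibleExponents F hβ
  obtain ⟨C, hC0, hC⟩ := isBigO_iff'.1 hβ
  have hsq : Tendsto (fun n : ℕ => n * n) atTop atTop :=
    tendsto_atTop_mono (fun n => Nat.le_mul_self n) tendsto_id
  have hC' : ∀ᶠ n : ℕ in atTop,
      ‖(tensorRankD (tetra F (n * n)) : ℝ)‖ ≤ C * ‖((n * n : ℕ) : ℝ) ^ β‖ := hsq.eventually hC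
  refine IsBigO.of_bound C ?_
  filter_upwards [hC', eventually_ge_atTop 1] with n hn hn1
  haveI : NeZero n := ⟨by omega⟩
  rw [Real.norm_of_nonneg (Nat.cast_nonneg _),
    Real.norm_of_nonneg (Real.rpow_nonneg (Nat.cast_nonneg _) _)] at hn ⊢
  have hn0 : (0 : ℝ) ≤ n := Nat.cast_nonneg _
  have hpow : (((n * n : ℕ) : ℝ)) ^ β = (n : ℝ) ^ (2 * β) := by
    push_cast
    rw [← sq, ← Real.rpow_natCast (n : ℝ) 2, ← Real.rpow_mul hn0]
    norm_num
  calc (tensorRankD (cone F n) : ℝ) ≤ (tensorRankD (tetra F (n * n)) : ℝ) := by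
        exact_mod_cast tensorRankD_cone_le_tetra_sq (F := F) n
    _ ≤ C * (((n * n : ℕ) : ℝ)) ^ β := hn
    _ = C * (n : ℝ) ^ (2 * β) := by rw [hpow]

/-- **`ω(W) ≤ 2·ω(K₄)`**, for every field (so `TetraFlat ⟹ ω(W) ≤ 8`, and with the cover
`ω(W) ≤ min(3ω, 2ω(K₄))`). [folklore] -/
theorem omegaCone_le_two_mul_omegaTetra : omegaCone F ≤ 2 * omegaTetra F := by
  have h : ∀ β ∈ tetraAdmissibleExponents F, omegaCone F / 2 ≤ β := fun β hβ => by
    have := csInf_le (coneAdmissibleExponents_bddBelow F) (two_mul_mem_coneAdmissibleExponents F hβ)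
    change omegaCone F ≤ 2 * β at this
    linarith
  have h2 : omegaCone F / 2 ≤ omegaTetra F := le_csInf (tetraAdmissibleExponents_nonempty F) h
  linarith

/-- The kernel sandwich `(3/2)·ω(K₄) ≤ ω(W) ≤ 2·ω(K₄)`. [folklore] -/
theorem omegaCone_sandwich :
    3 / 2 * omegaTetra F ≤ omegaCone F ∧ omegaCone F ≤ 2 * omegaTetra F := by
  refine ⟨?_, omegaCone_le_two_mul_omegaTetra F⟩
  have := omegaTetra_le_twoThirds_mul_omegaCone F
  linarith

end Restriction

end Summit.MatrixMultiplication.MatrixMultiplication.Theorems.ConeTensor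

end
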